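import Summits.CriticalPhenomena.PercolationContinuityZ3.Theorems.PercNearOneGluingNoHeavyPcintBSMXTail
import Summits.CriticalPhenomena.PercolationContinuityZ3.Theorems.PercNearOneGluingNoHeavyPcintBSMKernel
import HarnessLib

/-!
# PCINT lane, PHASE 6 (block renewal with reach-two pieces), step 5: the kernel layer (tables)

Cell `prim-pcint`, seat `prim-pcint-1` (gen 15); memo `run/shared/lean/prim/pcint/T-FIBRE-ROUTE.md` §PHASE 6.

Kernel mirrors of the ingredients of `BSMX.criticalProb_le_of_cert5`, part 1 (the analogue of …PcintBSMCompute for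
the five-point law `g₅ = (A₂, A₁, A₀, A₁, A₂)/DA`): WINDOWED fixed-point upper rows (**`BSMX.hrowW`**: a row is a list
of `2W+1` naturals, index `j ↔ δ = j - W`, bounding `H n δ · D` from above; outside the window the virtual value is
`D ≥ H · D`; one step = the five-term recursion `BSMX.H_succ_five` in ONE linear pass `BSMX.hpass` over the padded row,
rounded upwards; **`BSMX.hrowW_getD`**: `H (A₁/DA) (A₂/DA) n (j - W) · D ≤ row_n[j]` by monotonicity and `H ≤ 1`), the
short tables on `[-Dd, Dd]` (`BSMX.hvals`), the term data `BSMX.termsH` feeding the PHASE-5 fixed-point Green sum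
`BSM.GqN` (**`BSMX.G0H_le_GqN`**, **`BSMX.G1H_le_GqN`**), and the invariance of the Green sums under signed
permutations of the offset (`BSMX.G0H_canonK`, from evenness of `H`).  All kernel arithmetic is on small naturals;
the window makes the cost of `N` rows linear in `N`.
-/

noncomputable section

namespace Summit.CriticalPhenomena.PercolationContinuityZ3.Theorems.Pcint.BSMX

open Finset OSM BSM Literature.Probability.Percolation Literature.Probability.LatticeModels

variable {t k np : ℕ}

/-! ### The five-term linear pass -/

/-- One linear pass of the five-term stencil: reading `x` with state `(p4, p3, p2, p1)` (the four previous virtual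
entries) emits `A₂ (p4 + x) + A₁ (p3 + p1) + A₀ p2` (the new value at the position of `p2`). -/
def hpass (A0 A1 A2 : ℕ) : List ℕ → ℕ → ℕ → ℕ → ℕ → List ℕ
  | [], _, _, _, _ => []
  | x :: rest, p4, p3, p2, p1 => (A2 * (p4 + x) + A1 * (p3 + p1) + A0 * p2) :: hpass A0 A1 A2 rest p3 p2 p1 x

/-- Length of the linear pass. -/
theorem length_hpass (A0 A1 A2 : ℕ) : ∀ (l : List ℕ) (p4 p3 p2 p1 : ℕ), (hpass A0 A1 A2 l p4 p3 p2 p1).length = l.length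
  | [], _, _, _, _ => rfl
  | x :: rest, p4, p3, p2, p1 => by rw [hpass, List.length_cons, length_hpass, List.length_cons]

/-- Entries of the linear pass, in terms of the virtual list `V = p4 :: p3 :: p2 :: p1 :: l`. -/
theorem hpass_getD (A0 A1 A2 : ℕ) : ∀ (l : List ℕ) (p4 p3 p2 p1 j : ℕ), j < l.length →
    (hpass A0 A1 A2 l p4 p3 p2 p1).getD j 0 =
      A2 * ((p4 :: p3 :: p2 :: p1 :: l).getD j 0 + (p4 :: p3 :: p2 :: p1 :: l).getD (j + 4) 0) +
        A1 * ((p4 :: p3 :: p2 :: p1 :: l).getD (j + 1) 0 + (p4 :: p3 :: p2 :: p1 :: l).getD (j + 3) 0) +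
          A0 * (p4 :: p3 :: p2 :: p1 :: l).getD (j + 2) 0
  | [], _, _, _, _, j, hj => by simp at hj
  | x :: rest, p4, p3, p2, p1, 0, _ => by simp [hpass]
  | x :: rest, p4, p3, p2, p1, j + 1, hj => by
    rw [hpass, List.getD_cons_succ, hpass_getD A0 A1 A2 rest p3 p2 p1 x j (by simpa using hj)]
    rfl

/-! ### Windowed fixed-point upper rows of the five-point walk -/

/-- The padded row: two virtual entries `D` on each side. -/
def padRow (D : ℕ) (row : List ℕ) : List ℕ := D :: D :: (row ++ [D, D])

/-- **Windowed fixed-point upper rows** (denominator `D`, half-width `W`): row `0 = 𝟙[δ = 0] · D`, then the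
five-term recursion on the padded row, rounded upwards. -/
def hrowW (A0 A1 A2 DA D W : ℕ) : ℕ → List ℕ
  | 0 => (List.range (2 * W + 1)).map fun j : ℕ => if j = W then D else 0
  | n + 1 =>
    let P := padRow D (hrowW A0 A1 A2 DA D W n)
    (hpass A0 A1 A2 (P.drop 4) (P.getD 0 0) (P.getD 1 0) (P.getD 2 0) (P.getD 3 0)).map (cdiv DA)

/-- The rows have length `2W + 1`. -/
theorem length_hrowW (A0 A1 A2 DA D W : ℕ) : ∀ n, (hrowW A0 A1 A2 DA D W n).length = 2 * W + 1
  | 0 => by simp [hrowW]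
  | n + 1 => by
    rw [hrowW]
    simp only [List.length_map, length_hpass, List.length_drop, padRow, List.length_cons, List.length_append,
      List.length_nil, length_hrowW A0 A1 A2 DA D W n]
    omega

/-- Entries of the padded row. -/
theorem padRow_getD (D : ℕ) {row : List ℕ} {L : ℕ} (hL : row.length = L) (j : ℕ) (hj : j < L + 4) :
    (padRow D row).getD j 0 = if j < 2 then D else if j < L + 2 then row.getD (j - 2) 0 else D := by
  unfold padRow
  rcases j with _ | _ | j
  · simp
  · simp
  · simp only [List.getD_cons_succ, show ¬ (j + 1 + 1 < 2) from by omega, if_false,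
      show j + 1 + 1 - 2 = j from by omega]
    by_cases h : j < L
    · rw [if_pos (by omega), List.getD_append _ _ _ _ (by rw [hL]; exact h)]
    · rw [if_neg (by omega), List.getD_append_right _ _ _ _ (by rw [hL]; omega), hL]
      have : j - L = 0 ∨ j - L = 1 := by omega
      rcases this with e | e <;> rw [e] <;> simp

/-- The padded row re-assembled from its first four entries and the rest. -/
theorem padRow_eq (D : ℕ) (row : List ℕ) (hrow : 1 ≤ row.length) :
    (padRow D row).getD 0 0 :: (padRow D row).getD 1 0 :: (padRow D row).getD 2 0 :: (padRow D row).getD 3 0 ::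
      (padRow D row).drop 4 = padRow D row := by
  obtain ⟨a, rest, hr⟩ : ∃ a rest, row = a :: rest := by
    rcases row with _ | ⟨a, rest⟩
    · simp at hrow
    · exact ⟨a, rest, rfl⟩
  subst hr
  rcases rest with _ | ⟨b, rest⟩
  · rfl
  · rfl

/-- **One step of the rows, entrywise**: for `j ≤ 2W`, entry `j` of row `n+1` is the rounded stencil of the padded
row `n` at positions `j, …, j+4`. -/
theorem hrowW_succ_getD (A0 A1 A2 DA D W n j : ℕ) (hj : j ≤ 2 * W) :
    (hrowW A0 A1 A2 DA D W (n + 1)).getD j 0 =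
      cdiv DA (A2 * ((padRow D (hrowW A0 A1 A2 DA D W n)).getD j 0 + (padRow D (hrowW A0 A1 A2 DA D W n)).getD (j + 4) 0) +
        A1 * ((padRow D (hrowW A0 A1 A2 DA D W n)).getD (j + 1) 0 + (padRow D (hrowW A0 A1 A2 DA D W n)).getD (j + 3) 0) +
          A0 * (padRow D (hrowW A0 A1 A2 DA D W n)).getD (j + 2) 0) := by
  have hlen := length_hrowW A0 A1 A2 DA D W n
  set P := padRow D (hrowW A0 A1 A2 DA D W n) with hP
  have hdrop : (P.drop 4).length = 2 * W + 1 := by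
    rw [hP, List.length_drop, padRow, List.length_cons, List.length_cons, List.length_append, hlen]; simp
  rw [hrowW, getD_map_cdiv]
  rw [hpass_getD A0 A1 A2 _ _ _ _ _ j (by rw [hdrop]; omega), padRow_eq D _ (by rw [hlen]; omega)]

/-- **The fixed-point rows dominate**: `H (A₁/DA) (A₂/DA) n (j - W) · D ≤ (hrowW … n)[j]` for `j ≤ 2W`, provided
`A₀ + 2A₁ + 2A₂ = DA` (so that `A₀/DA = 1 - 2a₁ - 2a₂`). -/
theorem hrowW_getD {A0 A1 A2 DA : ℕ} (hDA : A0 + 2 * A1 + 2 * A2 = DA) (hDA0 : 0 < DA) (D W : ℕ) :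
    ∀ (n j : ℕ), j ≤ 2 * W →
      H ((A1 : ℝ) / DA) ((A2 : ℝ) / DA) n ((j : ℤ) - W) * D ≤ ((hrowW A0 A1 A2 DA D W n).getD j 0 : ℝ)
  | 0, j, hj => by
    rw [hrowW, getD_map_range _ _ (by omega), H_zero]
    by_cases h : j = W
    · subst h; simp
    · rw [if_neg (by omega), if_neg h]; simp
  | n + 1, j, hj => by
    have hDAR : (0 : ℝ) < DA := by exact_mod_cast hDA0
    set a₁ : ℝ := (A1 : ℝ) / DA with ha₁
    set a₂ : ℝ := (A2 : ℝ) / DA with ha₂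
    have h1 : 0 ≤ a₁ := by positivity
    have h2 : 0 ≤ a₂ := by positivity
    have h12 : 2 * a₁ + 2 * a₂ ≤ 1 := by
      rw [ha₁, ha₂]
      have : (2 * A1 + 2 * A2 : ℝ) ≤ DA := by exact_mod_cast (by omega : 2 * A1 + 2 * A2 ≤ DA)
      rw [show 2 * ((A1 : ℝ) / DA) + 2 * ((A2 : ℝ) / DA) = (2 * A1 + 2 * A2) / DA by ring, div_le_one hDAR]
      exact this
    have ha0 : 1 - 2 * a₁ - 2 * a₂ = (A0 : ℝ) / DA := by
      rw [ha₁, ha₂, eq_div_iff hDAR.ne']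
      have : ((A0 + 2 * A1 + 2 * A2 : ℕ) : ℝ) = DA := by exact_mod_cast hDA
      push_cast at this
      field_simp
      linarith
    have hlen := length_hrowW A0 A1 A2 DA D W n
    set P := padRow D (hrowW A0 A1 A2 DA D W n) with hP
    -- every padded entry dominates the corresponding value: position `i` of `P` is `δ = i - 2 - W`
    have hdom : ∀ i, i < 2 * W + 5 → H a₁ a₂ n ((i : ℤ) - 2 - W) * D ≤ (P.getD i 0 : ℝ) := by
      intro i hi
      rw [hP, padRow_getD D hlen i (by omega)]
      have hle1 : H a₁ a₂ n ((i : ℤ) - 2 - W) * D ≤ (D : ℝ) := by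
        have := H_le_one h1 h2 h12 n ((i : ℤ) - 2 - W)
        have hD : (0 : ℝ) ≤ D := Nat.cast_nonneg D
        nlinarith
      split_ifs with hi2 hi3
      · exact hle1
      · have := hrowW_getD hDA hDA0 D W n (i - 2) (by omega)
        rwa [show (((i - 2 : ℕ) : ℤ) - W) = (i : ℤ) - 2 - W by push_cast [Nat.cast_sub (by omega : 2 ≤ i)]; ring] at this
      · exact hle1
    rw [hrowW_succ_getD A0 A1 A2 DA D W n j hj]
    refine le_trans ?_ (le_cdiv hDA0 _)
    rw [H_succ_five, le_div_iff₀ hDAR]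
    have e0 := hdom j (by omega)
    have e1 := hdom (j + 1) (by omega)
    have e2 := hdom (j + 2) (by omega)
    have e3 := hdom (j + 3) (by omega)
    have e4 := hdom (j + 4) (by omega)
    have c0 : ((j : ℕ) : ℤ) - 2 - W = (j : ℤ) - (n + 1 : ℕ) + (n + 1 : ℕ) - W - 2 := by ring
    -- align the five offsets
    have f0 : H a₁ a₂ n ((j : ℤ) - W - 2) * D ≤ (P.getD j 0 : ℝ) := by
      convert e0 using 3; ring
    have f1 : H a₁ a₂ n ((j : ℤ) - W - 1) * D ≤ (P.getD (j + 1) 0 : ℝ) := by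
      convert e1 using 3; push_cast; ring
    have f2 : H a₁ a₂ n ((j : ℤ) - W) * D ≤ (P.getD (j + 2) 0 : ℝ) := by
      convert e2 using 3; push_cast; ring
    have f3 : H a₁ a₂ n ((j : ℤ) - W + 1) * D ≤ (P.getD (j + 3) 0 : ℝ) := by
      convert e3 using 3; push_cast; ring
    have f4 : H a₁ a₂ n ((j : ℤ) - W + 2) * D ≤ (P.getD (j + 4) 0 : ℝ) := by
      convert e4 using 3; push_cast; ring
    have hA0 : (0 : ℝ) ≤ A0 := Nat.cast_nonneg A0
    have hA1 : (0 : ℝ) ≤ A1 := Nat.cast_nonneg A1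
    have hA2 : (0 : ℝ) ≤ A2 := Nat.cast_nonneg A2
    rw [ha0]
    push_cast
    have key : ((A2 : ℝ) / DA * H a₁ a₂ n ((j : ℤ) - W + 2) + (A1 : ℝ) / DA * H a₁ a₂ n ((j : ℤ) - W + 1) +
        (A0 : ℝ) / DA * H a₁ a₂ n ((j : ℤ) - W) + (A1 : ℝ) / DA * H a₁ a₂ n ((j : ℤ) - W - 1) +
          (A2 : ℝ) / DA * H a₁ a₂ n ((j : ℤ) - W - 2)) * D * DA =
        A2 * (H a₁ a₂ n ((j : ℤ) - W - 2) * D + H a₁ a₂ n ((j : ℤ) - W + 2) * D) +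
          A1 * (H a₁ a₂ n ((j : ℤ) - W - 1) * D + H a₁ a₂ n ((j : ℤ) - W + 1) * D) +
            A0 * (H a₁ a₂ n ((j : ℤ) - W) * D) := by
      field_simp
      ring
    rw [ha₁, ha₂] at key ⊢
    rw [key]
    have m2 := mul_le_mul_of_nonneg_left (add_le_add f0 f4) hA2
    have m1 := mul_le_mul_of_nonneg_left (add_le_add f1 f3) hA1
    have m0 := mul_le_mul_of_nonneg_left f2 hA0
    linarith

/-- `H · D ≤ D` (the virtual value outside the window). -/
theorem H_mul_le {A0 A1 A2 DA : ℕ} (hDA : A0 + 2 * A1 + 2 * A2 = DA) (hDA0 : 0 < DA) (D n : ℕ) (δ : ℤ) :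
    H ((A1 : ℝ) / DA) ((A2 : ℝ) / DA) n δ * D ≤ (D : ℝ) := by
  have hDAR : (0 : ℝ) < DA := by exact_mod_cast hDA0
  have h12 : 2 * ((A1 : ℝ) / DA) + 2 * ((A2 : ℝ) / DA) ≤ 1 := by
    have : (2 * A1 + 2 * A2 : ℝ) ≤ DA := by exact_mod_cast (by omega : 2 * A1 + 2 * A2 ≤ DA)
    rw [show 2 * ((A1 : ℝ) / DA) + 2 * ((A2 : ℝ) / DA) = (2 * A1 + 2 * A2) / DA by ring, div_le_one hDAR]
    exact this
  have := H_le_one (by positivity) (by positivity) h12 n δ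
  have hD : (0 : ℝ) ≤ D := Nat.cast_nonneg D
  nlinarith

/-- All rows up to `M`, built with sharing. -/
def hrowsW (A0 A1 A2 DA D W : ℕ) : ℕ → List (List ℕ)
  | 0 => [hrowW A0 A1 A2 DA D W 0]
  | M + 1 =>
    let rs := hrowsW A0 A1 A2 DA D W M
    let P := padRow D (rs.getD M [])
    rs ++ [(hpass A0 A1 A2 (P.drop 4) (P.getD 0 0) (P.getD 1 0) (P.getD 2 0) (P.getD 3 0)).map (cdiv DA)]

/-- The list of rows is correct. -/
theorem hrowsW_getD (A0 A1 A2 DA D W : ℕ) :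
    ∀ (M n : ℕ), n ≤ M → (hrowsW A0 A1 A2 DA D W M).getD n [] = hrowW A0 A1 A2 DA D W n ∧
      (hrowsW A0 A1 A2 DA D W M).length = M + 1
  | 0, n, hn => by
    have : n = 0 := by omega
    subst this; exact ⟨rfl, rfl⟩
  | M + 1, n, hn => by
    have hlen : (hrowsW A0 A1 A2 DA D W M).length = M + 1 := (hrowsW_getD A0 A1 A2 DA D W M 0 (Nat.zero_le _)).2
    refine ⟨?_, by simp [hrowsW, hlen]⟩
    show (hrowsW A0 A1 A2 DA D W M ++ [_]).getD n [] = hrowW A0 A1 A2 DA D W n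
    rcases Nat.lt_or_ge n (M + 1) with h | h
    · rw [List.getD_append _ _ _ _ (by rw [hlen]; exact h)]
      exact (hrowsW_getD A0 A1 A2 DA D W M n (by omega)).1
    · have hn' : n = M + 1 := by omega
      subst hn'
      rw [List.getD_append_right _ _ _ _ (by rw [hlen])]
      rw [hlen, Nat.sub_self, List.getD_cons_zero, (hrowsW_getD A0 A1 A2 DA D W M M le_rfl).1]
      rfl

/-! ### Short tables and the fixed-point Green sums -/

/-- The entries `δ = -Dd, …, Dd` of a windowed row (index `j ↔ δ = j - Dd`), for `Dd ≤ W`. -/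
def hvals (row : List ℕ) (W Dd : ℕ) : List ℕ := (List.range (2 * Dd + 1)).map fun j : ℕ => row.getD (j + W - Dd) 0

/-- **Lookup in the short table dominates `H · D`.** -/
theorem hvals_getD {A0 A1 A2 DA : ℕ} (hDA : A0 + 2 * A1 + 2 * A2 = DA) (hDA0 : 0 < DA) (D : ℕ) {W Dd : ℕ}
    (hDd : Dd ≤ W) (n : ℕ) {δ : ℤ} (hδ : -(Dd : ℤ) ≤ δ ∧ δ ≤ Dd) :
    H ((A1 : ℝ) / DA) ((A2 : ℝ) / DA) n δ * D ≤
      (((hvals (hrowW A0 A1 A2 DA D W n) W Dd).getD (δ + Dd).toNat 0 : ℕ) : ℝ) := by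
  unfold hvals
  rw [getD_map_range _ _ (by omega)]
  have := hrowW_getD hDA hDA0 D W n ((δ + Dd).toNat + W - Dd) (by omega)
  rwa [show ((((δ + Dd).toNat + W - Dd : ℕ) : ℤ) - W) = δ by omega] at this

/-- The fixed-point term data `(Wc_i, short table of row 2i)`, `i < N`, for a coefficient list `Wc`. -/
def termsH (A0 A1 A2 DA D W N Dd : ℕ) (Wc : List ℕ) : List (ℕ × List ℕ) :=
  let rs := hrowsW A0 A1 A2 DA D W (2 * N)
  List.ofFn fun i : Fin N => (Wc.getD i 0, hvals (rs.getD (2 * i) []) W Dd)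

/-- **The fixed-point Green sum dominates** `Σ_{i<N} c_i Π_l H (2i) (δ l) · (DU · D^t)` whenever `c_i · DU ≤ Wc_i`. -/
theorem sum_le_GqN5 {A0 A1 A2 DA : ℕ} (hDA : A0 + 2 * A1 + 2 * A2 = DA) (hDA0 : 0 < DA) (D DU : ℕ) {W N Dd : ℕ}
    (hDd : Dd ≤ W) {Wc : List ℕ} {c : ℕ → ℝ} (hcW : ∀ i < N, c i * DU ≤ (Wc.getD i 0 : ℝ))
    {δ : Fin t → ℤ} (hδ : δ ∈ Box t Dd) :
    (∑ i ∈ range N, c i * ∏ l, H ((A1 : ℝ) / DA) ((A2 : ℝ) / DA) (2 * i) (δ l)) * ((DU : ℝ) * (D : ℝ) ^ t) ≤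
      ((GqN (termsH A0 A1 A2 DA D W N Dd Wc) Dd δ : ℕ) : ℝ) := by
  rw [mem_Box] at hδ
  have hDAR : (0 : ℝ) < DA := by exact_mod_cast hDA0
  set a₁ : ℝ := (A1 : ℝ) / DA
  set a₂ : ℝ := (A2 : ℝ) / DA
  have h1 : 0 ≤ a₁ := by positivity
  have h2 : 0 ≤ a₂ := by positivity
  have h12 : 2 * a₁ + 2 * a₂ ≤ 1 := by
    have : (2 * A1 + 2 * A2 : ℝ) ≤ DA := by exact_mod_cast (by omega : 2 * A1 + 2 * A2 ≤ DA)
    rw [show 2 * a₁ + 2 * a₂ = (2 * A1 + 2 * A2) / DA by ring, div_le_one hDAR]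
    exact this
  unfold GqN termsH
  rw [List.map_ofFn, List.sum_ofFn, ← Fin.sum_univ_eq_sum_range, sum_mul]
  push_cast
  refine sum_le_sum fun i _ => ?_
  have hiN : (i : ℕ) < N := i.2
  simp only [Function.comp_apply]
  rw [(hrowsW_getD A0 A1 A2 DA D W (2 * N) (2 * i) (by omega)).1]
  have hT : ∀ l, H a₁ a₂ (2 * i) (δ l) * D ≤
      (((hvals (hrowW A0 A1 A2 DA D W (2 * i)) W Dd).getD (δ l + Dd).toNat 0 : ℕ) : ℝ) :=
    fun l => hvals_getD hDA hDA0 D hDd (2 * i) (hδ l)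
  have hH0 : ∀ l, 0 ≤ H a₁ a₂ (2 * i) (δ l) := fun l => H_nonneg h1 h2 h12 _ _
  calc c i * (∏ l, H a₁ a₂ (2 * i) (δ l)) * ((DU : ℝ) * (D : ℝ) ^ t)
      = (c i * DU) * ∏ l, (H a₁ a₂ (2 * i) (δ l) * D) := by
        rw [prod_mul_distrib, prod_const, Finset.card_univ, Fintype.card_fin]; ring
    _ ≤ (Wc.getD i 0 : ℝ) * ∏ l, (((hvals (hrowW A0 A1 A2 DA D W (2 * i)) W Dd).getD (δ l + Dd).toNat 0 : ℕ) : ℝ) := by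
        refine mul_le_mul (hcW i hiN) (prod_le_prod (fun l _ => mul_nonneg (hH0 l) (by positivity))
          fun l _ => hT l) (prod_nonneg fun l _ => mul_nonneg (hH0 l) (by positivity)) (by positivity)
    _ = _ := by push_cast; rfl

/-- **`G0H · (DU · D^t) ≤ GqN`** for a coefficient list dominating `u k i · DU`. -/
theorem G0H_le_GqN {A0 A1 A2 DA : ℕ} (hDA : A0 + 2 * A1 + 2 * A2 = DA) (hDA0 : 0 < DA) (D DU : ℕ) {W N : ℕ}
    (hW : 12 ≤ W) {U : List ℕ} (hU : ∀ i < N, u k i * DU ≤ (U.getD i 0 : ℝ)) {δ : Fin t → ℤ} (hδ : δ ∈ Box t 12) :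
    G0H k ((A1 : ℝ) / DA) ((A2 : ℝ) / DA) N δ * ((DU : ℝ) * (D : ℝ) ^ t) ≤
      ((GqN (termsH A0 A1 A2 DA D W N 12 U) 12 δ : ℕ) : ℝ) :=
  sum_le_GqN5 hDA hDA0 D DU hW hU hδ

/-- **`G1H · (DU · D^t) ≤ GqN`** for a coefficient list dominating `cadj k i · DU`. -/
theorem G1H_le_GqN {A0 A1 A2 DA : ℕ} (hDA : A0 + 2 * A1 + 2 * A2 = DA) (hDA0 : 0 < DA) (D DU : ℕ)
    {W N : ℕ} (hW : 12 ≤ W) {C : List ℕ} (hC : ∀ i < N, cadj k i * DU ≤ (C.getD i 0 : ℝ)) {δ : Fin t → ℤ}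
    (hδ : δ ∈ Box t 12) :
    G1H k ((A1 : ℝ) / DA) ((A2 : ℝ) / DA) N δ * ((DU : ℝ) * (D : ℝ) ^ t) ≤
      ((GqN (termsH A0 A1 A2 DA D W N 12 C) 12 δ : ℕ) : ℝ) :=
  sum_le_GqN5 hDA hDA0 D DU hW hC hδ

/-! ### Symmetry of the Green terms: sorted absolute values -/

/-- **Products of the even function `H n` of the coordinates are invariant under canonicalisation.** -/
theorem prod_H_canonK (a₁ a₂ : ℝ) (n : ℕ) (δ : Fin t → ℤ) :
    ∏ l, H a₁ a₂ n (canonK δ l) = ∏ l, H a₁ a₂ n (δ l) := by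
  rw [← List.prod_ofFn, ← List.prod_ofFn]
  have h1 : List.ofFn (fun l => H a₁ a₂ n (canonK δ l)) = (List.ofFn (canonK δ)).map (H a₁ a₂ n) := by
    rw [List.map_ofFn]; rfl
  have h2 : List.ofFn (fun l => H a₁ a₂ n (δ l)) = (List.ofFn fun l => |δ l|).map (H a₁ a₂ n) := by
    rw [List.map_ofFn]; exact congr_arg _ (funext fun l => (H_abs a₁ a₂ n (δ l)).symm)
  rw [h1, h2, ofFn_canonK]
  exact ((perm_absSort δ).map _).prod_eq

/-- `G0H` is invariant under canonicalisation. -/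
theorem G0H_canonK (k : ℕ) (a₁ a₂ : ℝ) (N : ℕ) (δ : Fin t → ℤ) : G0H k a₁ a₂ N (canonK δ) = G0H k a₁ a₂ N δ := by
  unfold G0H; exact sum_congr rfl fun i _ => by rw [prod_H_canonK]

/-- `G1H` is invariant under canonicalisation. -/
theorem G1H_canonK (k : ℕ) (a₁ a₂ : ℝ) (N : ℕ) (δ : Fin t → ℤ) : G1H k a₁ a₂ N (canonK δ) = G1H k a₁ a₂ N δ := by
  unfold G1H; exact sum_congr rfl fun i _ => by rw [prod_H_canonK]

end Summit.CriticalPhenomena.PercolationContinuityZ3.Theorems.Pcint.BSMX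

end
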